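import Mathlib.Analysis.SpecialFunctions.Log.Basic
import Mathlib.Analysis.Complex.ExponentialBounds
import Summits.QuantumFields.BalabanUV.Beta.EriceRemainderEnclosureHistoryAutonomyComparisonAffineProfile

/-!
# EriceRemainderEnclosureHistoryAutonomyComparisonWindowSeven — (E63e) ALL MEMORY AGES WITHIN A FACTOR 7 COMPARE AT ANY SIZE: `B(u) = b + L_0·u_0 +
# Σ_{K₀ ≤ k ≤ 7K₀} L_k·u_k` (`b > 0`, ANY number of ages in the window `[K₀, 7K₀]`, `K₀ ≥ 1`, ALL sizes `L_k ≥ 0` and the Markov weight `L_0` ARBITRARY) passes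
# (E58b)'s profile condition — `Σ_j L_j∕P_j ≤ 2√2·log 2 < 2` — by a RIEMANN-SUM bound: ordering the ages, `P_j ≥ ρ·A_j + σ·(T − A_j)` (`A_j` the weight up
# to age `j`, `ρ = 1∕√2` the read of a younger age, `σ = ρ∕2` the least read of an older one in the window), and `Σ_j L_j∕(σT + (ρ−σ)A_j)` is a right-endpoint
# Riemann sum of the decreasing `1∕(σ + (ρ−σ)α)`, at most `∫_0^1 = log(ρ∕σ)∕(ρ−σ) = 2√2·log 2`; (E58c) had the factor `3` (`P_j ≥ T∕2`)

Cell `pub-balaban`, β-function sub-cell, BINDER row D4 «RemainderConst leaves for Bałaban's split» (`HOME/BINDER-OWNERS.md`; owner lineage `b2b-balaban-beta-an4`;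
this file by co-owner #2 lineage `b2b-balaban-beta-d4-p2`, generation 56), β-FLOW TEAM duty (1), FREEZE (0) honoured (def-free; (E58b)'s
`le_of_isotone_excess_affine_profile`, Mathlib's `Real.one_sub_inv_le_log_of_pos` ∕ `Real.log_two_lt_d9` ∕ `Finset.sum_range_sub` BY NAME; nothing restated).  Fifth file of
gen 56's station (E63); sequel of (E58c) `…ComparisonAffineProfileEnd` §2 (`le_of_isotone_excess_affine_window`, factor `3`).

HONEST FRAMING (page 1, verbatim and binding).  *"Discharging BetaPertH makes Bałaban's UV stability UNCONDITIONAL — a real constructive-QFT result; it is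
NOT the continuum limit and NOT the Clay problem."*  THIS FILE DISCHARGES NOTHING OF THE KIND.  Elementary real analysis about ABSTRACT affine functionals on
a box ]0,γ]^ℕ — hypotheses of a census, not facts; the age profile of Bałaban's (1.22) limit functional is NOT PRINTED ([I] p. 298; GAPS G-t4-U2-1∕-2) and NOT
asserted.  Row D4 class UNCHANGED (critical-path width 0; instance 0∕1; D4 DISCHARGE NO DATE).  HONEST DEPENDENCY: continuum YM on T⁴ ⇐ BetaPertH ∧ nine
spine estimates (0/9 proved); BetaPertH ⇐ (D1) ∧ (D4) ∧ CAP+tail; G-an2-4 gates asym, D1 and NE2/3/4.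

THE POINT (census sense (α); the COMPARISON column, conjecture (E58′)).  (E58b): `Σ_{j<K} L_j∕P_j ≤ 2`, `P_j = Σ_{k<K} L_k·√(j∕(j+k))`, suffices for comparison
at any size.  For a profile whose ages `k ≥ 1` lie in `[K₀, 7K₀]`: a YOUNGER age `k ≤ j` is read with weight `√(j∕(j+k)) ≥ 1∕√2 = ρ` (the Markov weight with
`1`), an OLDER one with `≥ √(K₀∕8K₀) = ρ∕2`; so with the cumulative weight `S_{j+1} = Σ_{i≤j} L_i` and the total `T`, `P_j ≥ ρ S_{j+1} + (ρ∕2)(T − S_{j+1}) =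
(ρ∕2)(T + S_{j+1})` (§2), and `L_j∕P_j ≤ (2∕ρ)·L_j∕(T + S_{j+1}) ≤ (2∕ρ)·(log(T + S_{j+1}) − log(T + S_j))` (`1 − x⁻¹ ≤ log x`; §1 `sum_div_cumul_le_log`,
the Riemann-sum-versus-integral bound for the decreasing `1∕(T + s)`); telescoping, `Σ_j L_j∕P_j ≤ (2∕ρ)·log(2T∕T) = 2√2·log 2 ≈ 1.9605 ≤ 2` (§2
`profileSum_le_of_window_seven`) — for ANY number of ages and ANY sizes.  §3: the comparison theorem (`le_of_isotone_excess_affine_window_seven`).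
Numerically the two-age profile sum crosses `2` only at ratio `≈ 130` and three geometric ages at ratio `≈ 12` per step (`HOME/…/g56/e63/README.md`); the
constant-`σ` Riemann bound is exhausted at the factor `≈ 7.7`.  NOT CLAIMED: factors above `7`; anything printed.

WHAT IS PROVED ([folklore]; 0 `def`, 0 sorry).  §1 **`sum_div_cumul_le_log`**.  §2 `read_ge_of_window_seven`, **`profileSum_le_of_window_seven`**.  §3
**`le_of_isotone_excess_affine_window_seven`**.
-/
noncomputable section
open Finset Set

namespace Summit.QuantumFields.BalabanUV.Beta.EriceRemainderEnclosureHistoryAutonomyComparisonWindowSeven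

open Literature.MathematicalPhysics.QuantumFieldTheory.Balaban1983to89
open Literature.MathematicalPhysics.QuantumFieldTheory.Balaban1983to89.T4BetaStationary
open Literature.MathematicalPhysics.QuantumFieldTheory.Balaban1983to89.T4BetaFlowWellPosed
open Summit.QuantumFields.BalabanUV.Beta.EriceRemainderEnclosureHistoryAutonomyComparisonAffineProfile (le_of_isotone_excess_affine_profile)

variable {B' : (ℕ → ℝ) → ℝ} {M' γ b : ℝ} {L : ℕ → ℝ} {K : ℕ} {h h' : ℕ → ℝ}

/-! ## §1 A right-endpoint Riemann sum of `1∕(c + s)` is at most the integral -/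

/-- **RIEMANN SUM VERSUS INTEGRAL FOR `1∕(c + s)`**: for `L ≥ 0` with partial sums `S_m = Σ_{i<m} L_i` and `c > 0`,
`Σ_{j<K} L_j ∕ (c + S_{j+1}) ≤ log(c + S_K) − log c` — each summand is `1 − x⁻¹ ≤ log x` for `x = (c + S_{j+1})∕(c + S_j)`, and the logs telescope.
[folklore] -/
theorem sum_div_cumul_le_log {c : ℝ} (hL : ∀ k, 0 ≤ L k) (hc : 0 < c) (K : ℕ) :
    ∑ j ∈ range K, L j / (c + ∑ i ∈ range (j + 1), L i) ≤ Real.log (c + ∑ i ∈ range K, L i) - Real.log c := by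
  have hS0 : ∀ m, 0 ≤ ∑ i ∈ range m, L i := fun m => sum_nonneg fun i _ => hL i
  have hpos : ∀ m, 0 < c + ∑ i ∈ range m, L i := fun m => by have := hS0 m; linarith
  have hstep : ∀ j, L j / (c + ∑ i ∈ range (j + 1), L i)
      ≤ Real.log (c + ∑ i ∈ range (j + 1), L i) - Real.log (c + ∑ i ∈ range j, L i) := by
    intro j
    have h1 := hpos j
    have h2 := hpos (j + 1)
    rw [← Real.log_div h2.ne' h1.ne']
    refine le_trans ?_ (Real.one_sub_inv_le_log_of_pos (div_pos h2 h1))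
    rw [inv_div, sum_range_succ]
    rw [sum_range_succ] at h2
    have e : 1 - (c + ∑ i ∈ range j, L i) / (c + (∑ i ∈ range j, L i + L j)) = L j / (c + (∑ i ∈ range j, L i + L j)) := by
      field_simp; ring
    rw [e]
  calc ∑ j ∈ range K, L j / (c + ∑ i ∈ range (j + 1), L i)
      ≤ ∑ j ∈ range K, (Real.log (c + ∑ i ∈ range (j + 1), L i) - Real.log (c + ∑ i ∈ range j, L i)) := sum_le_sum fun j _ => hstep j
    _ = Real.log (c + ∑ i ∈ range K, L i) - Real.log (c + ∑ i ∈ range 0, L i) :=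
        sum_range_sub (fun m => Real.log (c + ∑ i ∈ range m, L i)) K
    _ = Real.log (c + ∑ i ∈ range K, L i) - Real.log c := by rw [sum_range_zero, add_zero]

/-! ## §2 The profile sum of a factor-7 window -/

/-- THE READS ON A FACTOR-7 WINDOW: for `L ≥ 0` whose ages `k ≥ 1` lie in `[K₀, 7K₀]`, an age `j` of the window reads every `k ≤ j` with weight
`√(j∕(j+k)) ≥ √(1∕2)` and every `k` carrying weight with `≥ √(1∕2)∕2`; hence `P_j ≥ (√(1∕2)∕2)·(T + S_{j+1})`, `T = Σ_k L_k`, `S_{j+1} = Σ_{i≤j} L_i`. [folklore] -/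
theorem read_ge_of_window_seven {K₀ j : ℕ} (hL : ∀ k, 0 ≤ L k) (hK₀ : 1 ≤ K₀) (hwin : ∀ k, k ≠ 0 → L k ≠ 0 → K₀ ≤ k ∧ k ≤ 7 * K₀)
    (hjK : j < K) (hj : K₀ ≤ j) :
    Real.sqrt (1 / 2) / 2 * (∑ k ∈ range K, L k + ∑ i ∈ range (j + 1), L i) ≤ ∑ k ∈ range K, L k * Real.sqrt ((j : ℝ) / ((j : ℝ) + k)) := by
  have hK₀r : (1 : ℝ) ≤ K₀ := by exact_mod_cast hK₀
  have hjr : (K₀ : ℝ) ≤ j := by exact_mod_cast hj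
  have hjpos : (0 : ℝ) < j := by linarith
  set ρ : ℝ := Real.sqrt (1 / 2) with hρ_def
  have hρ0 : 0 < ρ := Real.sqrt_pos.mpr (by norm_num)
  have hρhalf : ρ / 2 = Real.sqrt (1 / 8) := by
    rw [hρ_def, show (1 : ℝ) / 8 = (1 / 2) ^ 2 * (1 / 2) by norm_num, Real.sqrt_mul (by norm_num), Real.sqrt_sq (by norm_num)]; ring
  -- split the cumulative sum: S_{j+1} = Σ_{k<K, k ≤ j} L_k (ages beyond K carry into range (j+1) only if j+1 > K; but j < K)
  have hsplit : ∑ i ∈ range (j + 1), L i = ∑ k ∈ (range K).filter (fun k => k ≤ j), L k := by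
    refine sum_congr ?_ fun _ _ => rfl
    ext k; simp only [Finset.mem_range, Finset.mem_filter]; omega
  rw [hsplit, mul_add, ← sum_filter_add_sum_filter_not (range K) (fun k => k ≤ j) (fun k => L k * Real.sqrt ((j : ℝ) / ((j : ℝ) + k)))]
  -- younger ages (k ≤ j): weight ≥ ρ ≥ ρ/2 + ρ/2; T = young + old
  have hT : ∑ k ∈ range K, L k = ∑ k ∈ (range K).filter (fun k => k ≤ j), L k + ∑ k ∈ (range K).filter (fun k => ¬k ≤ j), L k :=
    (sum_filter_add_sum_filter_not (range K) (fun k => k ≤ j) L).symm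
  rw [hT, mul_add]
  have hyoung : ∀ k ∈ (range K).filter (fun k => k ≤ j), ρ * L k ≤ L k * Real.sqrt ((j : ℝ) / ((j : ℝ) + k)) := by
    intro k hk
    obtain ⟨-, hkj⟩ := mem_filter.mp hk
    have hkr : (k : ℝ) ≤ j := by exact_mod_cast hkj
    have hk0 : (0 : ℝ) ≤ k := Nat.cast_nonneg k
    have : (1 : ℝ) / 2 ≤ (j : ℝ) / ((j : ℝ) + k) := by rw [div_le_div_iff₀ (by norm_num) (by linarith)]; linarith
    rw [mul_comm]; exact mul_le_mul_of_nonneg_left (Real.sqrt_le_sqrt this) (hL k)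
  have hold : ∀ k ∈ (range K).filter (fun k => ¬k ≤ j), ρ / 2 * L k ≤ L k * Real.sqrt ((j : ℝ) / ((j : ℝ) + k)) := by
    intro k hk
    obtain ⟨-, hkj⟩ := mem_filter.mp hk
    rcases (hL k).eq_or_lt with hLk | hLk
    · rw [← hLk]; simp
    have hk7 := (hwin k (by omega) hLk.ne').2
    have hkr : (k : ℝ) ≤ 7 * K₀ := by exact_mod_cast hk7
    have : (1 : ℝ) / 8 ≤ (j : ℝ) / ((j : ℝ) + k) := by
      rw [div_le_div_iff₀ (by norm_num) (by have : (0:ℝ) ≤ k := Nat.cast_nonneg k; linarith)]; nlinarith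
    rw [hρhalf, mul_comm]; exact mul_le_mul_of_nonneg_left (Real.sqrt_le_sqrt this) (hL k)
  have h1 := sum_le_sum hyoung
  have h2 := sum_le_sum hold
  rw [← mul_sum] at h1 h2
  have hy0 : 0 ≤ ∑ k ∈ (range K).filter (fun k => k ≤ j), L k := sum_nonneg fun k _ => hL k
  nlinarith

/-- **THE PROFILE SUM OF A FACTOR-7 WINDOW IS AT MOST `2√2·log 2 < 2`**: `L ≥ 0` with every age `k ≥ 1` carrying weight in `[K₀, 7K₀]` (`K₀ ≥ 1`; the Markov
weight `L_0` and the number of ages ARBITRARY): `Σ_{j<K} L_j∕P_j ≤ 2·(√2·log 2)` (`≈ 1.9605`). [folklore] -/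
theorem profileSum_le_of_window_seven {K₀ : ℕ} (hL : ∀ k, 0 ≤ L k) (hK₀ : 1 ≤ K₀) (hwin : ∀ k, k ≠ 0 → L k ≠ 0 → K₀ ≤ k ∧ k ≤ 7 * K₀) :
    ∑ j ∈ range K, L j / ∑ k ∈ range K, L k * Real.sqrt ((j : ℝ) / ((j : ℝ) + k)) ≤ 2 * (Real.sqrt 2 * Real.log 2) := by
  set T : ℝ := ∑ k ∈ range K, L k with hT_def
  have hT0 : 0 ≤ T := sum_nonneg fun k _ => hL k
  have hlog2 : 0 < Real.log 2 := Real.log_pos (by norm_num)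
  have hs2 : 0 < Real.sqrt 2 := by positivity
  rcases hT0.eq_or_lt with hT | hTpos
  · -- all weights vanish
    have hL0 : ∀ k ∈ range K, L k = 0 := fun k hk => (sum_eq_zero_iff_of_nonneg (fun k _ => hL k)).mp hT.symm k hk
    rw [sum_eq_zero fun j hj => by rw [hL0 j hj, zero_div]]
    positivity
  set ρ : ℝ := Real.sqrt (1 / 2) with hρ_def
  have hρ0 : 0 < ρ := Real.sqrt_pos.mpr (by norm_num)
  have hρs : Real.sqrt 2 * ρ = 1 := by rw [hρ_def, ← Real.sqrt_mul (by norm_num)]; norm_num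
  -- termwise: L_j/P_j ≤ (2/ρ)·L_j/(T + S_{j+1})
  have hterm : ∀ j ∈ range K, L j / ∑ k ∈ range K, L k * Real.sqrt ((j : ℝ) / ((j : ℝ) + k))
      ≤ 2 / ρ * (L j / (T + ∑ i ∈ range (j + 1), L i)) := by
    intro j hj
    have hS0 : 0 ≤ ∑ i ∈ range (j + 1), L i := sum_nonneg fun i _ => hL i
    rcases (hL j).eq_or_lt with hLj | hLj
    · rw [← hLj]; simp
    rcases Nat.eq_zero_or_pos j with rfl | hjpos
    · have hP0 : ∑ k ∈ range K, L k * Real.sqrt (((0 : ℕ) : ℝ) / (((0 : ℕ) : ℝ) + k)) = 0 := sum_eq_zero fun k _ => by simp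
      rw [hP0, div_zero]; positivity
    have hwj := hwin j hjpos.ne' hLj.ne'
    have hP := read_ge_of_window_seven hL hK₀ hwin (mem_range.mp hj) hwj.1
    have hden : 0 < ρ / 2 * (T + ∑ i ∈ range (j + 1), L i) := by positivity
    calc L j / ∑ k ∈ range K, L k * Real.sqrt ((j : ℝ) / ((j : ℝ) + k)) ≤ L j / (ρ / 2 * (T + ∑ i ∈ range (j + 1), L i)) :=
          div_le_div_of_nonneg_left (hL j) hden hP
      _ = 2 / ρ * (L j / (T + ∑ i ∈ range (j + 1), L i)) := by field_simp
  have hsum := sum_div_cumul_le_log hL hTpos K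
  rw [← hT_def] at hsum
  calc ∑ j ∈ range K, L j / ∑ k ∈ range K, L k * Real.sqrt ((j : ℝ) / ((j : ℝ) + k))
      ≤ ∑ j ∈ range K, 2 / ρ * (L j / (T + ∑ i ∈ range (j + 1), L i)) := sum_le_sum hterm
    _ = 2 / ρ * ∑ j ∈ range K, L j / (T + ∑ i ∈ range (j + 1), L i) := by rw [mul_sum]
    _ ≤ 2 / ρ * (Real.log (T + T) - Real.log T) := mul_le_mul_of_nonneg_left hsum (by positivity)
    _ = 2 / ρ * Real.log 2 := by rw [← Real.log_div (by positivity) hTpos.ne', show (T + T) / T = 2 by field_simp; ring]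
    _ = 2 * (Real.sqrt 2 * Real.log 2) := by
        have e : 2 / ρ = 2 * Real.sqrt 2 := by
          rw [div_eq_iff hρ0.ne']
          calc (2 : ℝ) = 2 * (Real.sqrt 2 * ρ) := by rw [hρs, mul_one]
            _ = 2 * Real.sqrt 2 * ρ := by ring
        rw [e]; ring

/-! ## §3 The comparison theorem -/

/-- **ALL MEMORY AGES WITHIN A FACTOR 7 OF EACH OTHER ⟹ COMPARISON AT ANY SIZE** (a Markov term `L_0·u_0` may ride along; ANY number of ages, ANY
sizes).  If the weights `L_k`, `k ≥ 1`, vanish outside a window `K₀ ≤ k ≤ 7K₀` (`K₀ ≥ 1`), the profile condition holds (§2: `2√2·log 2 ≤ 2` since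
`log 2 < 0.6932 < 1∕√2`), hence every `B′ ≥ B = b + Σ_{k<K} L_k·u_k` with a zeroth moment and an ISOTONE excess has `h′ ≤ h` at every scale from every
pin.  (E58c) `le_of_isotone_excess_affine_window`: factor `3`. [folklore] -/
theorem le_of_isotone_excess_affine_window_seven {p : ℝ} {K₀ : ℕ} (hL : ∀ k, 0 ≤ L k) (hb : 0 < b) (hK₀ : 1 ≤ K₀)
    (hwin : ∀ k, k ≠ 0 → L k ≠ 0 → K₀ ≤ k ∧ k ≤ 7 * K₀)
    (hB' : ∀ u u' : ℕ → ℝ, SeqBox γ u → SeqBox γ u' → ∀ D : ℝ, (∀ j, |u j - u' j| ≤ D) → |B' u - B' u'| ≤ M' * D) (hM' : 0 ≤ M')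
    (hexc : ∀ u, SeqBox γ u → (fun u : ℕ → ℝ => b + ∑ k ∈ range K, L k * u k) u ≤ B' u)
    (hDmono : ∀ u v : ℕ → ℝ, SeqBox γ u → SeqBox γ v → (∀ j, u j ≤ v j) →
      B' u - (fun u : ℕ → ℝ => b + ∑ k ∈ range K, L k * u k) u ≤ B' v - (fun u : ℕ → ℝ => b + ∑ k ∈ range K, L k * u k) v)
    (hp : 0 < p) (hpγ : p ≤ γ) (hh : SeqBox γ h) (hf : MemFlow (fun u : ℕ → ℝ => b + ∑ k ∈ range K, L k * u k) p h)
    (hh' : SeqBox γ h') (hf' : MemFlow B' p h') (j : ℕ) : h' j ≤ h j := by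
  refine le_of_isotone_excess_affine_profile hL hb ?_ hB' hM' hexc hDmono hp hpγ hh hf hh' hf' j
  have h1 := profileSum_le_of_window_seven (K := K) hL hK₀ hwin
  have hlog := Real.log_two_lt_d9
  have hs : Real.sqrt 2 < 1.4143 := by
    rw [show (1.4143 : ℝ) = Real.sqrt (1.4143 ^ 2) by rw [Real.sqrt_sq (by norm_num)]]
    exact Real.sqrt_lt_sqrt (by norm_num) (by norm_num)
  have hlog0 : 0 < Real.log 2 := Real.log_pos (by norm_num)
  nlinarith [Real.sqrt_nonneg 2]

end Summit.QuantumFields.BalabanUV.Beta.EriceRemainderEnclosureHistoryAutonomyComparisonWindowSeven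

end
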